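import Summits.CriticalPhenomena.PercolationContinuityZ3.Theorems.PercNearOneGluingNoHeavyLowerTailSahiGridPatternCoCountProductNProduct
import Summits.CriticalPhenomena.PercolationContinuityZ3.Theorems.PercNearOneGluingNoHeavyLowerTailSahiGridPatternCoCountProductNOrTwo
import Summits.CriticalPhenomena.PercolationContinuityZ3.Theorems.PercNearOneGluingNoHeavyLowerTailSahiGridPatternHarrisEquality

/-!
# `NoHeavyLowerTail` (crux stmt-CriticalPhenomena-4575), Sahi programme P1: **CONJECTURE A FOR `x ∨ y` AT CROSSED TEST PAIRS** —
# the exact slack identity, its reduction to ONE intrinsic certificate inequality, and two unconditional families (every `k`)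

Support file (Sahi cell, seat `prim-sahi-p1`, generation 42; `--supports stmt-CriticalPhenomena-4575`).  Pure proofs, no definitions, no `sorry`,
standard axioms.  Vocabulary of `…SahiGridPattern{,CellForm,DiagCert,DiagCertBlockAndT,CoCountProductT,CoCountProductN,CoCountProductNProduct,
CoCountProductNOrTwo,HarrisEquality}` (`glue`, `sect`, `ind`, `thetaVal`, `lamU`, `freeOf`, `cellOf`, `TotDist`, `thirdPt`).

THE MATHEMATICS (seat memo FROM-prim-sahi-p1-gen42, §2).  Outer block `S = {x≥1} ∨ {y≥1} ⊆ [3]²` with its recursive certificate `c`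
(`0 | 4 | 2 | 5` on the corner / the cells `(0,t≥1)` / `(s≥1,0)` / the top cube), inner block `V ⊆ [3]^k` (up-set) with a vector `d_V`, `A = S × V`, and
the co-count product `e(x) = 2^{k+3}·1_S(σ)1_V(q) − (8·1_S(σ) − c(σ))·(2^{k+1}1_V(q) − d_V(q))`.  Generations 40/41 proved its condition (N) at
CO-MONOTONE and at PRODUCT test pairs and showed (LP duality) that at the CROSSED pairs
    `P = {(σ,q) : σ_x ≥ 1, q ∈ A₀}`,   `Q = {(σ,q) : q ∈ B′} ∪ {(σ,q) : σ_y ≥ 1, q ∈ B}`   (`B′ ⊆ B`; all inner sets up-sets)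
no routing with `V`-independent multipliers exists.  Write, for inner sets `X, Y`,  `n(X,Y) = #(X∩Y∩V)`,  `d(X,Y) = Σ_{X∩Y} d_V`,
`α(X,Y) = #{(q,r) ∈ X×Y : q δ̸ r, q ∈ V}`,  `α′(X,Y) = #{… : r ∈ V}`,  `μ(X,Y) = #{… : q̄r ∈ V}`  (so `Θ_V(X×Y) = α + α′ − μ`).  THEN (exact bookkeeping):
  `e(P∩Q) − Θ_A(P×Q) = 12·[d(A₀,B) − Θ_V(A₀×B)] + 4·{ 3·d(A₀,B′) + [2^k n(A₀,B) − α(A₀,B)] + [2^k n(A₀,B) − α′(A₀,B)] + [2^k n(A₀,B′) − α′(A₀,B′)]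
                                                          − 3·2^k n(A₀,B′) − 2·[α(A₀,B′) − μ(A₀,B′)] }`,
where the three square brackets are coefficientwise-Harris slacks (`≥ 0` for up-sets) and `α − μ ≥ 0` is a Kleitman difference.  Hence:
* `diagCert_coProduct_N_orTwo_crossed` — (N) at the crossed pair holds as soon as `d_V` satisfies (N) at the single rectangle `(A₀,B)` and the ONE
  INTRINSIC INEQUALITY  `3·d(A₀,B′) + h_V(A₀,B) + h_V(B,A₀) + h_V(B′,A₀) ≥ 3·2^k n(A₀,B′) + 2·κ′_V(A₀,B′)`  (hypothesis `hX`, written out in sums) —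
  this is the reduction of the memo (the inequality holds for every certificate in every tested instance: `k = 2` exhaustively, `k = 3, 4` sampled /
  adversarially; it is what the `V`-dependent "principal defect rows" of generation 41 supply);
* `diagCert_coProduct_N_orTwo_crossed_of_sectionRow` — UNCONDITIONAL FAMILY 1: if `d_V` satisfies (N) at `(A₀,B)` and `(A₀,B′)` and
  `2·h_V(B′,A₀) ≤ κ′_V(A₀,B′) + h_V(A₀,B) + h_V(B,A₀)`, then (N) holds at the crossed pair (the section row `(A₀,B′)` suffices);
* `diagCert_coProduct_N_orTwo_crossed_of_harrisEq`, `…_of_indep` — UNCONDITIONAL FAMILY 2: if `N(B′∩V; A₀) = 2^k·#(A₀∩B′∩V)` (equality in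
  coefficientwise Harris for the up-sets `A₀`, `B′∩V` — by `harrisSlack_eq_zero_iff` exactly when they depend on complementary sets of coordinates),
  then (N) holds at the crossed pair for EVERY `d_V ≥ 0` with (N) (every `k`);
* `sStarD_blockAnd_orTwo_crossed_nonneg_of_indep` — with (T) for `d_V` in addition, `0 ≤ sStarD ((x∨y)×V) P Q` at these pairs.
Nothing in this file asserts Conjecture A in general or `PatternPos d` for `d ≥ 4`. [this work]
-/

namespace Summit.CriticalPhenomena.PercolationContinuityZ3.Theorems.SahiGridPattern

open Finset SahiGrid3
open scoped BigOperators

section Crossed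

variable {k : ℕ} {S Fx Gy : Finset (Pd (1 + 1))} {V : Finset (Pd k)} {A : Finset (Pd ((1 + 1) + k))}

/-- Indicator values of the outer half-space `{x ≥ 1}` on the nine cells. [this work] -/
theorem ind_cellX_vals (hFx : ∀ ξ η : Pd 1, glue ξ η ∈ Fx ↔ 1 ≤ ξ 0) :
    ind Fx (glue (fun _ => 0) (fun _ => 0)) = 0 ∧ ind Fx (glue (fun _ => 0) (fun _ => 1)) = 0 ∧ ind Fx (glue (fun _ => 0) (fun _ => 2)) = 0 ∧
    ind Fx (glue (fun _ => 1) (fun _ => 0)) = 1 ∧ ind Fx (glue (fun _ => 1) (fun _ => 1)) = 1 ∧ ind Fx (glue (fun _ => 1) (fun _ => 2)) = 1 ∧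
    ind Fx (glue (fun _ => 2) (fun _ => 0)) = 1 ∧ ind Fx (glue (fun _ => 2) (fun _ => 1)) = 1 ∧ ind Fx (glue (fun _ => 2) (fun _ => 2)) = 1 := by
  have f11 : (1:Fin 3) ≤ 1 := le_rfl
  have f12 : (1:Fin 3) ≤ 2 := by decide
  have f10 : ¬ (1:Fin 3) ≤ 0 := by decide
  unfold ind
  simp only [hFx, f11, f12, f10, if_true, if_false, and_self]

/-- Indicator values of the outer half-space `{y ≥ 1}` on the nine cells. [this work] -/
theorem ind_cellY_vals (hGy : ∀ ξ η : Pd 1, glue ξ η ∈ Gy ↔ 1 ≤ η 0) :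
    ind Gy (glue (fun _ => 0) (fun _ => 0)) = 0 ∧ ind Gy (glue (fun _ => 0) (fun _ => 1)) = 1 ∧ ind Gy (glue (fun _ => 0) (fun _ => 2)) = 1 ∧
    ind Gy (glue (fun _ => 1) (fun _ => 0)) = 0 ∧ ind Gy (glue (fun _ => 1) (fun _ => 1)) = 1 ∧ ind Gy (glue (fun _ => 1) (fun _ => 2)) = 1 ∧
    ind Gy (glue (fun _ => 2) (fun _ => 0)) = 0 ∧ ind Gy (glue (fun _ => 2) (fun _ => 1)) = 1 ∧ ind Gy (glue (fun _ => 2) (fun _ => 2)) = 1 := by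
  have f11 : (1:Fin 3) ≤ 1 := le_rfl
  have f12 : (1:Fin 3) ≤ 2 := by decide
  have f10 : ¬ (1:Fin 3) ≤ 0 := by decide
  unfold ind
  simp only [hGy, f11, f12, f10, if_true, if_false, and_self]

/-- **The six outer pair counts of the crossed configuration** (`S = x∨y`, first factor `{x≥1}`, second factor `⊤` resp. `{y≥1}`):
`(24, 20, 20)` and `(16, 16, 12)` for the weights `1_S(ξ)`, `1_S(η)`, `1_S(ξ̄η)`. [this work] -/
theorem outer_pairCounts_crossed (hS : ∀ ξ η : Pd 1, glue ξ η ∈ S ↔ (1 ≤ ξ 0 ∨ 1 ≤ η 0))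
    (hFx : ∀ ξ η : Pd 1, glue ξ η ∈ Fx ↔ 1 ≤ ξ 0) (hGy : ∀ ξ η : Pd 1, glue ξ η ∈ Gy ↔ 1 ≤ η 0) :
    (∑ ξ : Pd (1 + 1), ∑ η : Pd (1 + 1), ind Fx ξ * (if TotDist ξ η = true then (1:ℤ) else 0) * ind S ξ) = 24 ∧
    (∑ ξ : Pd (1 + 1), ∑ η : Pd (1 + 1), ind Fx ξ * (if TotDist ξ η = true then (1:ℤ) else 0) * ind S η) = 20 ∧
    (∑ ξ : Pd (1 + 1), ∑ η : Pd (1 + 1), ind Fx ξ * (if TotDist ξ η = true then (1:ℤ) else 0) * ind S (thirdPt ξ η)) = 20 ∧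
    (∑ ξ : Pd (1 + 1), ∑ η : Pd (1 + 1), ind Fx ξ * ind Gy η * (if TotDist ξ η = true then (1:ℤ) else 0) * ind S ξ) = 16 ∧
    (∑ ξ : Pd (1 + 1), ∑ η : Pd (1 + 1), ind Fx ξ * ind Gy η * (if TotDist ξ η = true then (1:ℤ) else 0) * ind S η) = 16 ∧
    (∑ ξ : Pd (1 + 1), ∑ η : Pd (1 + 1), ind Fx ξ * ind Gy η * (if TotDist ξ η = true then (1:ℤ) else 0) * ind S (thirdPt ξ η)) = 12 := by
  obtain ⟨h00, h11, h22, h01, h02, h10, h12, h20, h21, t01, t02, t10, t12, t20, t21⟩ := pd1_facts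
  obtain ⟨u00, u01, u02, u10, u11, u12, u20, u21, u22⟩ := ind_orTwo_vals hS
  obtain ⟨x00, x01, x02, x10, x11, x12, x20, x21, x22⟩ := ind_cellX_vals hFx
  obtain ⟨y00, y01, y02, y10, y11, y12, y20, y21, y22⟩ := ind_cellY_vals hGy
  refine ⟨?_, ?_, ?_, ?_, ?_, ?_⟩ <;>
  · simp only [sum_glue (n := 1) (k := 1), sum_pd1, ite_totDist_glue, thirdPt_glue,
      h00, h11, h22, h01, h02, h10, h12, h20, h21, t01, t02, t10, t12, t20, t21,
      u00, u01, u02, u10, u11, u12, u20, u21, u22, x00, x01, x02, x10, x11, x12, x20, x21, x22,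
      y00, y01, y02, y10, y11, y12, y20, y21, y22,
      Bool.false_eq_true, if_false, if_true, zero_mul, mul_zero, mul_one, zero_add, add_zero]
    norm_num

/-- **The four outer cell sums of the crossed configuration**: `#(Fx∩S) = 6`, `Σ_{Fx}(8·1_S − c) = 24`, `#(Fx∩Gy∩S) = 4`, `Σ_{Fx∩Gy}(8·1_S − c) = 12`. [this work] -/
theorem outer_cellSums_crossed (hS : ∀ ξ η : Pd 1, glue ξ η ∈ S ↔ (1 ≤ ξ 0 ∨ 1 ≤ η 0))
    (hFx : ∀ ξ η : Pd 1, glue ξ η ∈ Fx ↔ 1 ≤ ξ 0) (hGy : ∀ ξ η : Pd 1, glue ξ η ∈ Gy ↔ 1 ≤ η 0)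
    (dS : Pd (1 + 1) → ℤ) (hdS : dS (glue (fun _ => 0) (fun _ => 0)) = 0 ∧ dS (glue (fun _ => 0) (fun _ => 1)) = 4 ∧ dS (glue (fun _ => 0) (fun _ => 2)) = 4 ∧
      dS (glue (fun _ => 1) (fun _ => 0)) = 2 ∧ dS (glue (fun _ => 1) (fun _ => 1)) = 5 ∧ dS (glue (fun _ => 1) (fun _ => 2)) = 5 ∧
      dS (glue (fun _ => 2) (fun _ => 0)) = 2 ∧ dS (glue (fun _ => 2) (fun _ => 1)) = 5 ∧ dS (glue (fun _ => 2) (fun _ => 2)) = 5) :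
    (∑ ξ : Pd (1 + 1), ind Fx ξ * ind S ξ) = 6 ∧
    (∑ ξ : Pd (1 + 1), ind Fx ξ * (2 * (2:ℤ) ^ (1 + 1) * ind S ξ - dS ξ)) = 24 ∧
    (∑ ξ : Pd (1 + 1), ind Fx ξ * ind Gy ξ * ind S ξ) = 4 ∧
    (∑ ξ : Pd (1 + 1), ind Fx ξ * ind Gy ξ * (2 * (2:ℤ) ^ (1 + 1) * ind S ξ - dS ξ)) = 12 := by
  obtain ⟨s00, s01, s02, s10, s11, s12, s20, s21, s22⟩ := hdS
  obtain ⟨u00, u01, u02, u10, u11, u12, u20, u21, u22⟩ := ind_orTwo_vals hS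
  obtain ⟨x00, x01, x02, x10, x11, x12, x20, x21, x22⟩ := ind_cellX_vals hFx
  obtain ⟨y00, y01, y02, y10, y11, y12, y20, y21, y22⟩ := ind_cellY_vals hGy
  refine ⟨?_, ?_, ?_, ?_⟩ <;>
  · simp only [sum_glue (n := 1) (k := 1), sum_pd1, s00, s01, s02, s10, s11, s12, s20, s21, s22,
      u00, u01, u02, u10, u11, u12, u20, u21, u22, x00, x01, x02, x10, x11, x12, x20, x21, x22,
      y00, y01, y02, y10, y11, y12, y20, y21, y22, zero_mul, mul_zero, one_mul, mul_one, zero_add, add_zero]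
    norm_num

/-- The indicator of the crossed second test set `Q = {q ∈ B′} ∪ {σ_y ≥ 1, q ∈ B}` (`B′ ⊆ B`) at a glued point. [this work] -/
theorem ind_glue_crossedQ {Bp B0 : Finset (Pd k)} {Q : Finset (Pd ((1 + 1) + k))}
    (hQ : ∀ σ q, glue σ q ∈ Q ↔ (q ∈ Bp ∨ (σ ∈ Gy ∧ q ∈ B0))) (hsub : Bp ⊆ B0) (σ : Pd (1 + 1)) (q : Pd k) :
    ind Q (glue σ q) = ind Bp q + ind Gy σ * ind B0 q - ind Gy σ * ind Bp q := by
  unfold ind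
  simp only [hQ]
  by_cases h1 : q ∈ Bp
  · have h2 : q ∈ B0 := hsub h1
    by_cases h3 : σ ∈ Gy <;> simp [h1, h2, h3]
  · by_cases h2 : q ∈ B0 <;> by_cases h3 : σ ∈ Gy <;> simp [h1, h2, h3]

/-- **THEOREM (Conjecture A for `S = x ∨ y` at CROSSED test pairs, reduced to one intrinsic inequality; every `k`).**
`S = {x≥1} ∨ {y≥1}` (`hS`), `dS` its recursive certificate (`hdS`), `A = S × V`; outer half-spaces `Fx = {x≥1}`, `Gy = {y≥1}` (`hFx`, `hGy`); inner sets
`A₀, B′ ⊆ B ⊆ [3]^k`, `V`, and any vector `d_V`; `P = Fx × A₀` (`hP`), `Q = {q ∈ B′} ∪ (Gy × B)` (`hQ`).  If `d_V` satisfies (N) at the one rectangle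
`(A₀, B)` (`hNB`) and the intrinsic inequality `hX` (`3·d_V(A₀∩B′) + h_V(A₀,B) + h_V(B,A₀) + h_V(B′,A₀) ≥ 3·2^k·#(A₀∩B′∩V) + 2κ′_V(A₀,B′)`, written out as
indicator sums), then the co-count product satisfies (N) at `(P,Q)`.  (No up-set hypothesis is needed for this bookkeeping step.) [this work] -/
theorem diagCert_coProduct_N_orTwo_crossed (hS : ∀ ξ η : Pd 1, glue ξ η ∈ S ↔ (1 ≤ ξ 0 ∨ 1 ≤ η 0))
    (hFx : ∀ ξ η : Pd 1, glue ξ η ∈ Fx ↔ 1 ≤ ξ 0) (hGy : ∀ ξ η : Pd 1, glue ξ η ∈ Gy ↔ 1 ≤ η 0)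
    (hA : ∀ σ z, glue σ z ∈ A ↔ (σ ∈ S ∧ z ∈ V))
    (dS : Pd (1 + 1) → ℤ) (hdS : dS (glue (fun _ => 0) (fun _ => 0)) = 0 ∧ dS (glue (fun _ => 0) (fun _ => 1)) = 4 ∧ dS (glue (fun _ => 0) (fun _ => 2)) = 4 ∧
      dS (glue (fun _ => 1) (fun _ => 0)) = 2 ∧ dS (glue (fun _ => 1) (fun _ => 1)) = 5 ∧ dS (glue (fun _ => 1) (fun _ => 2)) = 5 ∧
      dS (glue (fun _ => 2) (fun _ => 0)) = 2 ∧ dS (glue (fun _ => 2) (fun _ => 1)) = 5 ∧ dS (glue (fun _ => 2) (fun _ => 2)) = 5)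
    (dV : Pd k → ℤ) {A0 Bp B0 : Finset (Pd k)} (hsub : Bp ⊆ B0)
    (hNB : (∑ q ∈ A0, ∑ r ∈ B0, thetaVal V q r) ≤ ∑ q ∈ A0 ∩ B0, dV q)
    (hX : 3 * (2:ℤ) ^ k * (∑ q : Pd k, ind A0 q * ind Bp q * ind V q)
          + 2 * ((∑ q : Pd k, ∑ r : Pd k, ind A0 q * ind Bp r * (if TotDist q r = true then (1:ℤ) else 0) * ind V q)
                 - (∑ q : Pd k, ∑ r : Pd k, ind A0 q * ind Bp r * (if TotDist q r = true then (1:ℤ) else 0) * ind V (thirdPt q r)))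
        ≤ 3 * (∑ q : Pd k, ind A0 q * ind Bp q * dV q)
          + ((2:ℤ) ^ k * (∑ q : Pd k, ind A0 q * ind B0 q * ind V q) - (∑ q : Pd k, ∑ r : Pd k, ind A0 q * ind B0 r * (if TotDist q r = true then (1:ℤ) else 0) * ind V q))
          + ((2:ℤ) ^ k * (∑ q : Pd k, ind A0 q * ind B0 q * ind V q) - (∑ q : Pd k, ∑ r : Pd k, ind A0 q * ind B0 r * (if TotDist q r = true then (1:ℤ) else 0) * ind V r))
          + ((2:ℤ) ^ k * (∑ q : Pd k, ind A0 q * ind Bp q * ind V q) - (∑ q : Pd k, ∑ r : Pd k, ind A0 q * ind Bp r * (if TotDist q r = true then (1:ℤ) else 0) * ind V r)))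
    {P Q : Finset (Pd ((1 + 1) + k))} (hP : ∀ σ q, glue σ q ∈ P ↔ (σ ∈ Fx ∧ q ∈ A0)) (hQ : ∀ σ q, glue σ q ∈ Q ↔ (q ∈ Bp ∨ (σ ∈ Gy ∧ q ∈ B0))) :
    (∑ x ∈ P, ∑ y ∈ Q, thetaVal A x y) ≤ ∑ x ∈ P ∩ Q, (2 * (2:ℤ) ^ ((1 + 1) + k) * (ind S (freeOf x) * ind V (cellOf x))
        - (2 * (2:ℤ) ^ (1 + 1) * ind S (freeOf x) - dS (freeOf x)) * (2 * (2:ℤ) ^ k * ind V (cellOf x) - dV (cellOf x))) := by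
  obtain ⟨c24, c20, c20', c16, c16', c12⟩ := outer_pairCounts_crossed hS hFx hGy
  obtain ⟨e6, e24, e4, e12⟩ := outer_cellSums_crossed hS hFx hGy dS hdS
  -- names for the inner counts
  set a : ℤ := ∑ q : Pd k, ∑ r : Pd k, ind A0 q * ind B0 r * (if TotDist q r = true then (1:ℤ) else 0) * ind V q with ha
  set a' : ℤ := ∑ q : Pd k, ∑ r : Pd k, ind A0 q * ind B0 r * (if TotDist q r = true then (1:ℤ) else 0) * ind V r with ha'
  set m : ℤ := ∑ q : Pd k, ∑ r : Pd k, ind A0 q * ind B0 r * (if TotDist q r = true then (1:ℤ) else 0) * ind V (thirdPt q r) with hm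
  set b : ℤ := ∑ q : Pd k, ∑ r : Pd k, ind A0 q * ind Bp r * (if TotDist q r = true then (1:ℤ) else 0) * ind V q with hb
  set b' : ℤ := ∑ q : Pd k, ∑ r : Pd k, ind A0 q * ind Bp r * (if TotDist q r = true then (1:ℤ) else 0) * ind V r with hb'
  set mb : ℤ := ∑ q : Pd k, ∑ r : Pd k, ind A0 q * ind Bp r * (if TotDist q r = true then (1:ℤ) else 0) * ind V (thirdPt q r) with hmb
  set nB : ℤ := ∑ q : Pd k, ind A0 q * ind B0 q * ind V q with hnB
  set yB : ℤ := ∑ q : Pd k, ind A0 q * ind B0 q * dV q with hyB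
  set nBp : ℤ := ∑ q : Pd k, ind A0 q * ind Bp q * ind V q with hnBp
  set yBp : ℤ := ∑ q : Pd k, ind A0 q * ind Bp q * dV q with hyBp
  -- outer counts as named sums
  set O1 : ℤ := ∑ ξ : Pd (1 + 1), ∑ η : Pd (1 + 1), ind Fx ξ * (if TotDist ξ η = true then (1:ℤ) else 0) * ind S ξ with hO1
  set O2 : ℤ := ∑ ξ : Pd (1 + 1), ∑ η : Pd (1 + 1), ind Fx ξ * (if TotDist ξ η = true then (1:ℤ) else 0) * ind S η with hO2
  set O3 : ℤ := ∑ ξ : Pd (1 + 1), ∑ η : Pd (1 + 1), ind Fx ξ * (if TotDist ξ η = true then (1:ℤ) else 0) * ind S (thirdPt ξ η) with hO3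
  set O1' : ℤ := ∑ ξ : Pd (1 + 1), ∑ η : Pd (1 + 1), ind Fx ξ * ind Gy η * (if TotDist ξ η = true then (1:ℤ) else 0) * ind S ξ with hO1'
  set O2' : ℤ := ∑ ξ : Pd (1 + 1), ∑ η : Pd (1 + 1), ind Fx ξ * ind Gy η * (if TotDist ξ η = true then (1:ℤ) else 0) * ind S η with hO2'
  set O3' : ℤ := ∑ ξ : Pd (1 + 1), ∑ η : Pd (1 + 1), ind Fx ξ * ind Gy η * (if TotDist ξ η = true then (1:ℤ) else 0) * ind S (thirdPt ξ η) with hO3'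
  set s1 : ℤ := ∑ ξ : Pd (1 + 1), ind Fx ξ * ind S ξ with hs1
  set c1 : ℤ := ∑ ξ : Pd (1 + 1), ind Fx ξ * (2 * (2:ℤ) ^ (1 + 1) * ind S ξ - dS ξ) with hc1
  set s2 : ℤ := ∑ ξ : Pd (1 + 1), ind Fx ξ * ind Gy ξ * ind S ξ with hs2
  set c2 : ℤ := ∑ ξ : Pd (1 + 1), ind Fx ξ * ind Gy ξ * (2 * (2:ℤ) ^ (1 + 1) * ind S ξ - dS ξ) with hc2
  -- (1) the left side
  have hL1 : (∑ x ∈ P, ∑ y ∈ Q, thetaVal A x y) =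
      (O1 * b + O2 * b' - O3 * mb) + (O1' * a + O2' * a' - O3' * m) - (O1' * b + O2' * b' - O3' * mb) := by
    rw [theta_pairs_eq_sum4 (n := 1 + 1) (k := k)]
    have hpt : ∀ (ξ : Pd (1 + 1)) (q : Pd k) (η : Pd (1 + 1)) (r : Pd k),
        ind P (glue ξ q) * ind Q (glue η r) * thetaVal A (glue ξ q) (glue η r) =
          ((ind Fx ξ * (if TotDist ξ η = true then (1:ℤ) else 0) * ind S ξ) * (ind A0 q * ind Bp r * (if TotDist q r = true then (1:ℤ) else 0) * ind V q)
           + (ind Fx ξ * (if TotDist ξ η = true then (1:ℤ) else 0) * ind S η) * (ind A0 q * ind Bp r * (if TotDist q r = true then (1:ℤ) else 0) * ind V r)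
           - (ind Fx ξ * (if TotDist ξ η = true then (1:ℤ) else 0) * ind S (thirdPt ξ η)) * (ind A0 q * ind Bp r * (if TotDist q r = true then (1:ℤ) else 0) * ind V (thirdPt q r)))
          + ((ind Fx ξ * ind Gy η * (if TotDist ξ η = true then (1:ℤ) else 0) * ind S ξ) * (ind A0 q * ind B0 r * (if TotDist q r = true then (1:ℤ) else 0) * ind V q)
           + (ind Fx ξ * ind Gy η * (if TotDist ξ η = true then (1:ℤ) else 0) * ind S η) * (ind A0 q * ind B0 r * (if TotDist q r = true then (1:ℤ) else 0) * ind V r)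
           - (ind Fx ξ * ind Gy η * (if TotDist ξ η = true then (1:ℤ) else 0) * ind S (thirdPt ξ η)) * (ind A0 q * ind B0 r * (if TotDist q r = true then (1:ℤ) else 0) * ind V (thirdPt q r)))
          - ((ind Fx ξ * ind Gy η * (if TotDist ξ η = true then (1:ℤ) else 0) * ind S ξ) * (ind A0 q * ind Bp r * (if TotDist q r = true then (1:ℤ) else 0) * ind V q)
           + (ind Fx ξ * ind Gy η * (if TotDist ξ η = true then (1:ℤ) else 0) * ind S η) * (ind A0 q * ind Bp r * (if TotDist q r = true then (1:ℤ) else 0) * ind V r)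
           - (ind Fx ξ * ind Gy η * (if TotDist ξ η = true then (1:ℤ) else 0) * ind S (thirdPt ξ η)) * (ind A0 q * ind Bp r * (if TotDist q r = true then (1:ℤ) else 0) * ind V (thirdPt q r))) := by
      intro ξ q η r
      rw [thetaVal_eq_ite_mul, ite_totDist_glue, thirdPt_glue, ind_glue_product hA, ind_glue_product hA, ind_glue_product hA,
        ind_glue_product hP, ind_glue_crossedQ hQ hsub]
      ring
    rw [Finset.sum_congr rfl fun ξ _ => Finset.sum_congr rfl fun q _ => Finset.sum_congr rfl fun η _ =>
      Finset.sum_congr rfl fun r _ => hpt ξ q η r]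
    simp only [Finset.sum_sub_distrib, Finset.sum_add_distrib]
    rw [sum4_mul_eq, sum4_mul_eq, sum4_mul_eq, sum4_mul_eq, sum4_mul_eq, sum4_mul_eq, sum4_mul_eq, sum4_mul_eq, sum4_mul_eq]
  -- (2) the right side, by the three product pieces of `1_P·1_Q`
  set G1 : Pd (1 + 1) → Pd k → ℤ := fun ξ q => 2 * (2:ℤ) ^ ((1 + 1) + k) * ((ind Fx ξ * ind S ξ) * (ind A0 q * ind Bp q * ind V q))
      - (ind Fx ξ * (2 * (2:ℤ) ^ (1 + 1) * ind S ξ - dS ξ)) * (ind A0 q * ind Bp q * (2 * (2:ℤ) ^ k * ind V q - dV q)) with hG1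
  set G2 : Pd (1 + 1) → Pd k → ℤ := fun ξ q => 2 * (2:ℤ) ^ ((1 + 1) + k) * ((ind Fx ξ * ind Gy ξ * ind S ξ) * (ind A0 q * ind B0 q * ind V q))
      - (ind Fx ξ * ind Gy ξ * (2 * (2:ℤ) ^ (1 + 1) * ind S ξ - dS ξ)) * (ind A0 q * ind B0 q * (2 * (2:ℤ) ^ k * ind V q - dV q)) with hG2
  set G3 : Pd (1 + 1) → Pd k → ℤ := fun ξ q => 2 * (2:ℤ) ^ ((1 + 1) + k) * ((ind Fx ξ * ind Gy ξ * ind S ξ) * (ind A0 q * ind Bp q * ind V q))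
      - (ind Fx ξ * ind Gy ξ * (2 * (2:ℤ) ^ (1 + 1) * ind S ξ - dS ξ)) * (ind A0 q * ind Bp q * (2 * (2:ℤ) ^ k * ind V q - dV q)) with hG3
  have hv1 : (∑ q : Pd k, ind A0 q * ind Bp q * (2 * (2:ℤ) ^ k * ind V q - dV q)) = 2 * (2:ℤ) ^ k * nBp - yBp := by
    rw [hnBp, hyBp, Finset.mul_sum, ← Finset.sum_sub_distrib]
    refine Finset.sum_congr rfl fun q _ => ?_; ring
  have hv2 : (∑ q : Pd k, ind A0 q * ind B0 q * (2 * (2:ℤ) ^ k * ind V q - dV q)) = 2 * (2:ℤ) ^ k * nB - yB := by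
    rw [hnB, hyB, Finset.mul_sum, ← Finset.sum_sub_distrib]
    refine Finset.sum_congr rfl fun q _ => ?_; ring
  have hg1 : (∑ ξ : Pd (1 + 1), ∑ q : Pd k, G1 ξ q) = 2 * (2:ℤ) ^ ((1 + 1) + k) * (s1 * nBp) - c1 * (2 * (2:ℤ) ^ k * nBp - yBp) := by
    rw [hG1, sum2_linComb, hv1]
  have hg2 : (∑ ξ : Pd (1 + 1), ∑ q : Pd k, G2 ξ q) = 2 * (2:ℤ) ^ ((1 + 1) + k) * (s2 * nB) - c2 * (2 * (2:ℤ) ^ k * nB - yB) := by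
    rw [hG2, sum2_linComb, hv2]
  have hg3 : (∑ ξ : Pd (1 + 1), ∑ q : Pd k, G3 ξ q) = 2 * (2:ℤ) ^ ((1 + 1) + k) * (s2 * nBp) - c2 * (2 * (2:ℤ) ^ k * nBp - yBp) := by
    rw [hG3, sum2_linComb, hv1]
  have hR1 : (∑ x ∈ P ∩ Q, (2 * (2:ℤ) ^ ((1 + 1) + k) * (ind S (freeOf x) * ind V (cellOf x))
        - (2 * (2:ℤ) ^ (1 + 1) * ind S (freeOf x) - dS (freeOf x)) * (2 * (2:ℤ) ^ k * ind V (cellOf x) - dV (cellOf x)))) =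
      (2 * (2:ℤ) ^ ((1 + 1) + k) * (s1 * nBp) - c1 * (2 * (2:ℤ) ^ k * nBp - yBp))
      + (2 * (2:ℤ) ^ ((1 + 1) + k) * (s2 * nB) - c2 * (2 * (2:ℤ) ^ k * nB - yB))
      - (2 * (2:ℤ) ^ ((1 + 1) + k) * (s2 * nBp) - c2 * (2 * (2:ℤ) ^ k * nBp - yBp)) := by
    rw [sum_mem_eq_sum_ind_mul (P ∩ Q), sum_glue (n := 1 + 1) (k := k)]
    have hpt : ∀ (ξ : Pd (1 + 1)) (q : Pd k), ind (P ∩ Q) (glue ξ q) * (2 * (2:ℤ) ^ ((1 + 1) + k) * (ind S (freeOf (glue ξ q)) * ind V (cellOf (glue ξ q)))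
        - (2 * (2:ℤ) ^ (1 + 1) * ind S (freeOf (glue ξ q)) - dS (freeOf (glue ξ q))) * (2 * (2:ℤ) ^ k * ind V (cellOf (glue ξ q)) - dV (cellOf (glue ξ q)))) =
        G1 ξ q + G2 ξ q - G3 ξ q := by
      intro ξ q
      rw [hG1, hG2, hG3, ind_inter_eq_mul, ind_glue_product hP, ind_glue_crossedQ hQ hsub, freeOf_glue, cellOf_glue]
      ring
    rw [Finset.sum_congr rfl fun ξ _ => Finset.sum_congr rfl fun q _ => hpt ξ q]
    simp only [Finset.sum_sub_distrib, Finset.sum_add_distrib]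
    rw [hg1, hg2, hg3]
  -- (3) (N_V) at (A0,B0): a + a' − m ≤ yB
  have hΘV : a + a' - m ≤ yB := by
    have h := hNB
    rw [theta_rect_eq_counts V A0 B0] at h
    have e : (∑ q ∈ A0 ∩ B0, dV q) = yB := by
      rw [hyB, sum_mem_eq_sum_ind_mul (A0 ∩ B0)]
      refine Finset.sum_congr rfl fun q _ => ?_
      rw [ind_inter_eq_mul]
    rw [e] at h
    exact h
  -- (4) conclusion
  rw [hL1, hR1, c24, c20, c20', c16, c16', c12, e6, e24, e4, e12, pow_add]
  have h4 : (2:ℤ) ^ (1 + 1) = 4 := by norm_num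
  rw [h4]
  linarith [hΘV, hX]

/-- **COROLLARY 1 (the section-row regime; every `k`).**  In the setting of `diagCert_coProduct_N_orTwo_crossed`, if `d_V` satisfies (N) at the two section
rectangles `(A₀,B)` and `(A₀,B′)` and  `2·h_V(B′,A₀) ≤ κ′_V(A₀,B′) + h_V(A₀,B) + h_V(B,A₀)`  (hypothesis `hH`, in indicator sums), then (N) holds at the
crossed pair — the section row `(A₀,B′)` already supplies the needed mass on `A₀ ∩ B′`. [this work] -/
theorem diagCert_coProduct_N_orTwo_crossed_of_sectionRow (hS : ∀ ξ η : Pd 1, glue ξ η ∈ S ↔ (1 ≤ ξ 0 ∨ 1 ≤ η 0))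
    (hFx : ∀ ξ η : Pd 1, glue ξ η ∈ Fx ↔ 1 ≤ ξ 0) (hGy : ∀ ξ η : Pd 1, glue ξ η ∈ Gy ↔ 1 ≤ η 0)
    (hA : ∀ σ z, glue σ z ∈ A ↔ (σ ∈ S ∧ z ∈ V))
    (dS : Pd (1 + 1) → ℤ) (hdS : dS (glue (fun _ => 0) (fun _ => 0)) = 0 ∧ dS (glue (fun _ => 0) (fun _ => 1)) = 4 ∧ dS (glue (fun _ => 0) (fun _ => 2)) = 4 ∧
      dS (glue (fun _ => 1) (fun _ => 0)) = 2 ∧ dS (glue (fun _ => 1) (fun _ => 1)) = 5 ∧ dS (glue (fun _ => 1) (fun _ => 2)) = 5 ∧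
      dS (glue (fun _ => 2) (fun _ => 0)) = 2 ∧ dS (glue (fun _ => 2) (fun _ => 1)) = 5 ∧ dS (glue (fun _ => 2) (fun _ => 2)) = 5)
    (dV : Pd k → ℤ) {A0 Bp B0 : Finset (Pd k)} (hsub : Bp ⊆ B0)
    (hNB : (∑ q ∈ A0, ∑ r ∈ B0, thetaVal V q r) ≤ ∑ q ∈ A0 ∩ B0, dV q)
    (hNBp : (∑ q ∈ A0, ∑ r ∈ Bp, thetaVal V q r) ≤ ∑ q ∈ A0 ∩ Bp, dV q)
    (hH : 2 * ((2:ℤ) ^ k * (∑ q : Pd k, ind A0 q * ind Bp q * ind V q) - (∑ q : Pd k, ∑ r : Pd k, ind A0 q * ind Bp r * (if TotDist q r = true then (1:ℤ) else 0) * ind V r))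
        ≤ ((∑ q : Pd k, ∑ r : Pd k, ind A0 q * ind Bp r * (if TotDist q r = true then (1:ℤ) else 0) * ind V q)
             - (∑ q : Pd k, ∑ r : Pd k, ind A0 q * ind Bp r * (if TotDist q r = true then (1:ℤ) else 0) * ind V (thirdPt q r)))
          + ((2:ℤ) ^ k * (∑ q : Pd k, ind A0 q * ind B0 q * ind V q) - (∑ q : Pd k, ∑ r : Pd k, ind A0 q * ind B0 r * (if TotDist q r = true then (1:ℤ) else 0) * ind V q))
          + ((2:ℤ) ^ k * (∑ q : Pd k, ind A0 q * ind B0 q * ind V q) - (∑ q : Pd k, ∑ r : Pd k, ind A0 q * ind B0 r * (if TotDist q r = true then (1:ℤ) else 0) * ind V r)))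
    {P Q : Finset (Pd ((1 + 1) + k))} (hP : ∀ σ q, glue σ q ∈ P ↔ (σ ∈ Fx ∧ q ∈ A0)) (hQ : ∀ σ q, glue σ q ∈ Q ↔ (q ∈ Bp ∨ (σ ∈ Gy ∧ q ∈ B0))) :
    (∑ x ∈ P, ∑ y ∈ Q, thetaVal A x y) ≤ ∑ x ∈ P ∩ Q, (2 * (2:ℤ) ^ ((1 + 1) + k) * (ind S (freeOf x) * ind V (cellOf x))
        - (2 * (2:ℤ) ^ (1 + 1) * ind S (freeOf x) - dS (freeOf x)) * (2 * (2:ℤ) ^ k * ind V (cellOf x) - dV (cellOf x))) := by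
  -- (N_V) at (A0,Bp) in pair-count form
  have hrow : (∑ q : Pd k, ∑ r : Pd k, ind A0 q * ind Bp r * (if TotDist q r = true then (1:ℤ) else 0) * ind V q)
      + (∑ q : Pd k, ∑ r : Pd k, ind A0 q * ind Bp r * (if TotDist q r = true then (1:ℤ) else 0) * ind V r)
      - (∑ q : Pd k, ∑ r : Pd k, ind A0 q * ind Bp r * (if TotDist q r = true then (1:ℤ) else 0) * ind V (thirdPt q r))
      ≤ ∑ q : Pd k, ind A0 q * ind Bp q * dV q := by
    have h := hNBp
    rw [theta_rect_eq_counts V A0 Bp] at h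
    have e : (∑ q ∈ A0 ∩ Bp, dV q) = ∑ q : Pd k, ind A0 q * ind Bp q * dV q := by
      rw [sum_mem_eq_sum_ind_mul (A0 ∩ Bp)]
      refine Finset.sum_congr rfl fun q _ => ?_
      rw [ind_inter_eq_mul]
    rw [e] at h
    exact h
  refine diagCert_coProduct_N_orTwo_crossed hS hFx hGy hA dS hdS dV hsub hNB ?_ hP hQ
  linarith

/-- **COROLLARY 2 (equality in coefficientwise Harris for `(A₀, B′∩V)`; every `k`, every certificate).**  In the same setting with `A₀, B′, B, V` up-sets and
`d_V ≥ 0` satisfying (N) for `V`: if `N(B′∩V; A₀) = 2^k · #(A₀ ∩ B′ ∩ V)` (hypothesis `hEq`, pair-count form), then (N) holds at the crossed pair. [this work] -/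
theorem diagCert_coProduct_N_orTwo_crossed_of_harrisEq (hS : ∀ ξ η : Pd 1, glue ξ η ∈ S ↔ (1 ≤ ξ 0 ∨ 1 ≤ η 0))
    (hFx : ∀ ξ η : Pd 1, glue ξ η ∈ Fx ↔ 1 ≤ ξ 0) (hGy : ∀ ξ η : Pd 1, glue ξ η ∈ Gy ↔ 1 ≤ η 0)
    (hV : IsUpperSet (V : Set (Pd k))) (hA : ∀ σ z, glue σ z ∈ A ↔ (σ ∈ S ∧ z ∈ V))
    (dS : Pd (1 + 1) → ℤ) (hdS : dS (glue (fun _ => 0) (fun _ => 0)) = 0 ∧ dS (glue (fun _ => 0) (fun _ => 1)) = 4 ∧ dS (glue (fun _ => 0) (fun _ => 2)) = 4 ∧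
      dS (glue (fun _ => 1) (fun _ => 0)) = 2 ∧ dS (glue (fun _ => 1) (fun _ => 1)) = 5 ∧ dS (glue (fun _ => 1) (fun _ => 2)) = 5 ∧
      dS (glue (fun _ => 2) (fun _ => 0)) = 2 ∧ dS (glue (fun _ => 2) (fun _ => 1)) = 5 ∧ dS (glue (fun _ => 2) (fun _ => 2)) = 5)
    (dV : Pd k → ℤ)
    (hNV : ∀ X X' : Finset (Pd k), IsUpperSet (X : Set (Pd k)) → IsUpperSet (X' : Set (Pd k)) → (∑ q ∈ X, ∑ r ∈ X', thetaVal V q r) ≤ ∑ q ∈ X ∩ X', dV q)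
    {A0 Bp B0 : Finset (Pd k)} (hA0 : IsUpperSet (A0 : Set (Pd k))) (hBp : IsUpperSet (Bp : Set (Pd k))) (hB0 : IsUpperSet (B0 : Set (Pd k)))
    (hsub : Bp ⊆ B0)
    (hEq : (∑ q : Pd k, ∑ r : Pd k, ind A0 q * ind Bp r * (if TotDist q r = true then (1:ℤ) else 0) * ind V r)
        = (2:ℤ) ^ k * (∑ q : Pd k, ind A0 q * ind Bp q * ind V q))
    {P Q : Finset (Pd ((1 + 1) + k))} (hP : ∀ σ q, glue σ q ∈ P ↔ (σ ∈ Fx ∧ q ∈ A0)) (hQ : ∀ σ q, glue σ q ∈ Q ↔ (q ∈ Bp ∨ (σ ∈ Gy ∧ q ∈ B0))) :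
    (∑ x ∈ P, ∑ y ∈ Q, thetaVal A x y) ≤ ∑ x ∈ P ∩ Q, (2 * (2:ℤ) ^ ((1 + 1) + k) * (ind S (freeOf x) * ind V (cellOf x))
        - (2 * (2:ℤ) ^ (1 + 1) * ind S (freeOf x) - dS (freeOf x)) * (2 * (2:ℤ) ^ k * ind V (cellOf x) - dV (cellOf x))) := by
  have hH1 : (∑ q : Pd k, ∑ r : Pd k, ind A0 q * ind B0 r * (if TotDist q r = true then (1:ℤ) else 0) * ind V q)
      ≤ 2 ^ k * ∑ q : Pd k, ind A0 q * ind B0 q * ind V q := pairCount_le_harris hV hA0 hB0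
  have hH2 : (∑ q : Pd k, ∑ r : Pd k, ind A0 q * ind B0 r * (if TotDist q r = true then (1:ℤ) else 0) * ind V r)
      ≤ 2 ^ k * ∑ q : Pd k, ind A0 q * ind B0 q * ind V q := pairCount_le_harris' hV hA0 hB0
  have hK : (∑ q : Pd k, ∑ r : Pd k, ind A0 q * ind Bp r * (if TotDist q r = true then (1:ℤ) else 0) * ind V (thirdPt q r))
      ≤ ∑ q : Pd k, ∑ r : Pd k, ind A0 q * ind Bp r * (if TotDist q r = true then (1:ℤ) else 0) * ind V q := latCount_le_pairCount hV hA0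
  refine diagCert_coProduct_N_orTwo_crossed_of_sectionRow hS hFx hGy hA dS hdS dV hsub (hNV A0 B0 hA0 hB0) (hNV A0 Bp hA0 hBp) ?_ hP hQ
  rw [hEq]
  linarith

/-- **COROLLARY 3 (independent corner: `A₀` and `B′ ∩ V` depend on complementary coordinates; every `k`, every certificate).**  If there is a set of
coordinates `I` such that membership in `A₀` depends only on the coordinates in `I` and membership in `B′ ∩ V` only on those outside `I`, then (N) holds at
the crossed pair for every `d_V` with (N) for `V` (Harris equality via `harrisSlack_eq_zero_iff`). [this work] -/
theorem diagCert_coProduct_N_orTwo_crossed_of_indep (hS : ∀ ξ η : Pd 1, glue ξ η ∈ S ↔ (1 ≤ ξ 0 ∨ 1 ≤ η 0))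
    (hFx : ∀ ξ η : Pd 1, glue ξ η ∈ Fx ↔ 1 ≤ ξ 0) (hGy : ∀ ξ η : Pd 1, glue ξ η ∈ Gy ↔ 1 ≤ η 0)
    (hV : IsUpperSet (V : Set (Pd k))) (hA : ∀ σ z, glue σ z ∈ A ↔ (σ ∈ S ∧ z ∈ V))
    (dS : Pd (1 + 1) → ℤ) (hdS : dS (glue (fun _ => 0) (fun _ => 0)) = 0 ∧ dS (glue (fun _ => 0) (fun _ => 1)) = 4 ∧ dS (glue (fun _ => 0) (fun _ => 2)) = 4 ∧
      dS (glue (fun _ => 1) (fun _ => 0)) = 2 ∧ dS (glue (fun _ => 1) (fun _ => 1)) = 5 ∧ dS (glue (fun _ => 1) (fun _ => 2)) = 5 ∧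
      dS (glue (fun _ => 2) (fun _ => 0)) = 2 ∧ dS (glue (fun _ => 2) (fun _ => 1)) = 5 ∧ dS (glue (fun _ => 2) (fun _ => 2)) = 5)
    (dV : Pd k → ℤ)
    (hNV : ∀ X X' : Finset (Pd k), IsUpperSet (X : Set (Pd k)) → IsUpperSet (X' : Set (Pd k)) → (∑ q ∈ X, ∑ r ∈ X', thetaVal V q r) ≤ ∑ q ∈ X ∩ X', dV q)
    {A0 Bp B0 : Finset (Pd k)} (hA0 : IsUpperSet (A0 : Set (Pd k))) (hBp : IsUpperSet (Bp : Set (Pd k))) (hB0 : IsUpperSet (B0 : Set (Pd k)))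
    (hsub : Bp ⊆ B0)
    (hI : ∃ I : Finset (Fin k), (∀ x y : Pd k, (∀ a ∈ I, x a = y a) → (x ∈ A0 ↔ y ∈ A0)) ∧
        (∀ x y : Pd k, (∀ a ∉ I, x a = y a) → (x ∈ Bp ∩ V ↔ y ∈ Bp ∩ V)))
    {P Q : Finset (Pd ((1 + 1) + k))} (hP : ∀ σ q, glue σ q ∈ P ↔ (σ ∈ Fx ∧ q ∈ A0)) (hQ : ∀ σ q, glue σ q ∈ Q ↔ (q ∈ Bp ∨ (σ ∈ Gy ∧ q ∈ B0))) :
    (∑ x ∈ P, ∑ y ∈ Q, thetaVal A x y) ≤ ∑ x ∈ P ∩ Q, (2 * (2:ℤ) ^ ((1 + 1) + k) * (ind S (freeOf x) * ind V (cellOf x))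
        - (2 * (2:ℤ) ^ (1 + 1) * ind S (freeOf x) - dS (freeOf x)) * (2 * (2:ℤ) ^ k * ind V (cellOf x) - dV (cellOf x))) := by
  have hEq0 := (harrisSlack_eq_zero_iff A0 (Bp ∩ V) hA0 (isUpperSet_inter_coe hBp hV)).2 hI
  have e1 : (∑ p : Pd k, ∑ q : Pd k, ind A0 p * ind (Bp ∩ V) q * (if TotDist p q = true then (1:ℤ) else 0))
      = ∑ q : Pd k, ∑ r : Pd k, ind A0 q * ind Bp r * (if TotDist q r = true then (1:ℤ) else 0) * ind V r := by
    refine Finset.sum_congr rfl fun p _ => Finset.sum_congr rfl fun q _ => ?_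
    rw [ind_inter_eq_mul]; ring
  have e2 : (2:ℤ) ^ k * (∑ p : Pd k, ind A0 p * ind (Bp ∩ V) p) = (2:ℤ) ^ k * (∑ q : Pd k, ind A0 q * ind Bp q * ind V q) := by
    congr 1
    refine Finset.sum_congr rfl fun p _ => ?_
    rw [ind_inter_eq_mul]; ring
  rw [e1, e2] at hEq0
  exact diagCert_coProduct_N_orTwo_crossed_of_harrisEq hS hFx hGy hV hA dS hdS dV hNV hA0 hBp hB0 hsub hEq0 hP hQ

/-- **COROLLARY 4 (the pattern functional at crossed pairs with an independent corner; every `k`).**  With (T) for `dS` and `d_V` and the box `dS ≤ 8·1_S` in addition,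
`0 ≤ sStarD ((x∨y) × V) P Q` at every crossed pair `(P, Q)` whose corner `(A₀, B′∩V)` is independent. [this work] -/
theorem sStarD_blockAnd_orTwo_crossed_nonneg_of_indep (hS : ∀ ξ η : Pd 1, glue ξ η ∈ S ↔ (1 ≤ ξ 0 ∨ 1 ≤ η 0))
    (hFx : ∀ ξ η : Pd 1, glue ξ η ∈ Fx ↔ 1 ≤ ξ 0) (hGy : ∀ ξ η : Pd 1, glue ξ η ∈ Gy ↔ 1 ≤ η 0)
    (hV : IsUpperSet (V : Set (Pd k))) (hA : ∀ σ z, glue σ z ∈ A ↔ (σ ∈ S ∧ z ∈ V))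
    (dS : Pd (1 + 1) → ℤ) (hdS : dS (glue (fun _ => 0) (fun _ => 0)) = 0 ∧ dS (glue (fun _ => 0) (fun _ => 1)) = 4 ∧ dS (glue (fun _ => 0) (fun _ => 2)) = 4 ∧
      dS (glue (fun _ => 1) (fun _ => 0)) = 2 ∧ dS (glue (fun _ => 1) (fun _ => 1)) = 5 ∧ dS (glue (fun _ => 1) (fun _ => 2)) = 5 ∧
      dS (glue (fun _ => 2) (fun _ => 0)) = 2 ∧ dS (glue (fun _ => 2) (fun _ => 1)) = 5 ∧ dS (glue (fun _ => 2) (fun _ => 2)) = 5)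
    (hTS : ∀ W : Finset (Pd (1 + 1)), IsUpperSet (W : Set (Pd (1 + 1))) → (∑ ξ ∈ W, dS ξ) ≤ ∑ ξ ∈ W, lamU S ξ)
    (hmS : ∀ ξ : Pd (1 + 1), dS ξ ≤ 2 * (2:ℤ) ^ (1 + 1) * ind S ξ)
    (dV : Pd k → ℤ)
    (hTV : ∀ W : Finset (Pd k), IsUpperSet (W : Set (Pd k)) → (∑ q ∈ W, dV q) ≤ ∑ q ∈ W, lamU V q)
    (hNV : ∀ X X' : Finset (Pd k), IsUpperSet (X : Set (Pd k)) → IsUpperSet (X' : Set (Pd k)) → (∑ q ∈ X, ∑ r ∈ X', thetaVal V q r) ≤ ∑ q ∈ X ∩ X', dV q)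
    {A0 Bp B0 : Finset (Pd k)} (hA0 : IsUpperSet (A0 : Set (Pd k))) (hBp : IsUpperSet (Bp : Set (Pd k))) (hB0 : IsUpperSet (B0 : Set (Pd k)))
    (hsub : Bp ⊆ B0)
    (hI : ∃ I : Finset (Fin k), (∀ x y : Pd k, (∀ a ∈ I, x a = y a) → (x ∈ A0 ↔ y ∈ A0)) ∧
        (∀ x y : Pd k, (∀ a ∉ I, x a = y a) → (x ∈ Bp ∩ V ↔ y ∈ Bp ∩ V)))
    {P Q : Finset (Pd ((1 + 1) + k))} (hPu : IsUpperSet (P : Set (Pd ((1 + 1) + k)))) (hQu : IsUpperSet (Q : Set (Pd ((1 + 1) + k))))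
    (hP : ∀ σ q, glue σ q ∈ P ↔ (σ ∈ Fx ∧ q ∈ A0)) (hQ : ∀ σ q, glue σ q ∈ Q ↔ (q ∈ Bp ∨ (σ ∈ Gy ∧ q ∈ B0))) :
    0 ≤ sStarD A P Q := by
  rw [sStarD_eq_sum_lamU_sub_sum_thetaVal]
  have hT := diagCert_coProduct_T hA dS dV hTS hTV hmS (isUpperSet_inter_coe hPu hQu)
  have hN := diagCert_coProduct_N_orTwo_crossed_of_indep hS hFx hGy hV hA dS hdS dV hNV hA0 hBp hB0 hsub hI hP hQ
  linarith

end Crossed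

end Summit.CriticalPhenomena.PercolationContinuityZ3.Theorems.SahiGridPattern
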